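import Summits.KontsevichZagierPeriods.KontsevichZagierPeriods.Theorems.RealEllipticSectorKernel.Negative.Lemniscatic
import Summits.KontsevichZagierPeriods.KontsevichZagierPeriods.Theorems.RealEllipticSectorKernel.Negative.RootsCM66

/-!
# `RealEllipticSectorKernel` (stmt-KontsevichZagierPeriods-10632), negative side: the rational 2-isogeny of `y² = 4x³ − 44x + 56`

Support lemmas for the cdisprove finding F9 (`Negative/CMPoint.lean`): on the CM curve
`f = 4x³ − 44x + 56` (`(q₂,q₃) = (44,−56)`, `j = 66³`; roots in `Negative/RootsCM66.lean`) the
substitution `Ψ(x) = −(x + 1/(x−2))/4` (a rescaling of Vélu's 2-isogeny `x ↦ x + 1/(x−2)` with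
kernel the rational 2-torsion point `(2,0)`, target `Y² = u³ − 16u`) satisfies the exact weight
identity `4Ψ³ − 4Ψ = −f·Ψ′²/4` (`Ψ_key`), maps `(e₂,2)` injectively onto `(1,∞)` and each half of
the bounded oval (cut at the fold `x = 1`) injectively onto `(0,1)`; whence
`∫_(e₂,2) dx/√(−f) = Λ/4` and `∫_(e₃,e₂) dx/√f = Λ/2`, `Λ/2 = Γ(1/4)²/(4√(2π))`:
**`J₀ = 2K₀`** (`J_eq_two_K_cm`), an INTEGER relation between the real and the imaginary
half-period, with no transcendence input.

Sources: M. Kontsevich, D. Zagier, *Periods* (2001), §§1.1–1.2; J. Vélu, *Isogénies entre courbes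
elliptiques*, C. R. Acad. Sci. Paris 273 (1971) 238–241; D. Masser, *Elliptic Functions and
Transcendence*, LNM 437 (1975), Ch. III. -/

noncomputable section

namespace Summit.KontsevichZagierPeriods.RealEllipticSectorKernel.CM66

open MeasureTheory Set

/-! ### The isogeny substitution `Ψ(x) = −(x + 1/(x−2))/4` -/

/-- `Ψ = −φ/4`, `φ(x) = x + 1/(x − 2)` the Vélu 2-isogeny with kernel `(2,0)`. [folklore] -/
def Ψ (x : ℝ) : ℝ := -(x + (x - 2)⁻¹) / 4

/-- `Ψ'`. [folklore] -/
def Ψ' (x : ℝ) : ℝ := -(1 - ((x - 2) ^ 2)⁻¹) / 4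

/-- Auxiliary step of the isogeny / two-torsion computation (F9–F10). [folklore] -/
theorem hasDerivAt_Ψ {x : ℝ} (hx : x ≠ 2) : HasDerivAt Ψ (Ψ' x) x := by
  have hx' : x - 2 ≠ 0 := sub_ne_zero.mpr hx
  have h1 : HasDerivAt (fun y : ℝ => (y - 2)⁻¹) (-(1:ℝ) / (x - 2) ^ 2) x :=
    ((hasDerivAt_id x).sub_const 2).inv hx'
  have h2 := ((hasDerivAt_id x).add h1).neg.div_const 4
  have h3 : HasDerivAt (fun y : ℝ => -(id y + (y - 2)⁻¹) / 4) (Ψ' x) x := by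
    refine h2.congr_deriv ?_
    unfold Ψ'
    ring
  exact h3

/-- **The isogeny weight identity**: `4Ψ³ − 4Ψ = −f·Ψ'²/4` (i.e. `f′(φ) = f φ′²` for the target
cubic `f′(u) = 4u³ − 64u`). [folklore] -/
theorem Ψ_key {x : ℝ} (hx : x ≠ 2) : 4 * Ψ x ^ 3 - 4 * Ψ x = -(fcm x) * Ψ' x ^ 2 / 4 := by
  have hx' : x - 2 ≠ 0 := sub_ne_zero.mpr hx
  unfold Ψ Ψ' fcm
  field_simp
  ring

/-- Auxiliary step of the isogeny / two-torsion computation (F9–F10). [folklore] -/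
theorem Ψ_e₂ : Ψ e₂ = 1 := by
  have h2 := sqrt2_sq
  unfold Ψ
  rw [div_eq_iff (by norm_num : (4:ℝ) ≠ 0)]
  have hprod : (e₂ - 2) * (-(3 + 2 * Real.sqrt 2)) = 1 := by
    unfold e₂; nlinarith [h2]
  rw [inv_eq_of_mul_eq_one_right hprod]
  unfold e₂
  ring

/-- Auxiliary step of the isogeny / two-torsion computation (F9–F10). [folklore] -/
theorem Ψ_e₃ : Ψ e₃ = 1 := by
  have h2 := sqrt2_sq
  unfold Ψ
  rw [div_eq_iff (by norm_num : (4:ℝ) ≠ 0)]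
  have hprod : (e₃ - 2) * (-(3 - 2 * Real.sqrt 2)) = 1 := by
    unfold e₃; nlinarith [h2]
  rw [inv_eq_of_mul_eq_one_right hprod]
  unfold e₃
  ring

/-- Auxiliary step of the isogeny / two-torsion computation (F9–F10). [folklore] -/
theorem Ψ_one : Ψ 1 = 0 := by norm_num [Ψ]

/-- Auxiliary step of the isogeny / two-torsion computation (F9–F10). [folklore] -/
theorem Ψ_eq {x : ℝ} (hx : x ≠ 2) : Ψ x = -((x - 1) ^ 2) / (4 * (x - 2)) := by
  have hx' : x - 2 ≠ 0 := sub_ne_zero.mpr hx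
  unfold Ψ
  field_simp
  ring

/-- Auxiliary step of the isogeny / two-torsion computation (F9–F10). [folklore] -/
theorem Ψ_sub_one {x : ℝ} (hx : x ≠ 2) : Ψ x - 1 = -((x - e₂) * (x - e₃)) / (4 * (x - 2)) := by
  have hx' : x - 2 ≠ 0 := sub_ne_zero.mpr hx
  rw [quad_factor]
  unfold Ψ
  field_simp
  ring

/-- Auxiliary step of the isogeny / two-torsion computation (F9–F10). [folklore] -/
theorem Ψ_pos {x : ℝ} (hx2 : x < 2) (hx1 : x ≠ 1) : 0 < Ψ x := by
  rw [Ψ_eq hx2.ne]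
  have h1 : 0 < (x - 1) ^ 2 := by positivity
  have h2 : 4 * (x - 2) < 0 := by linarith
  exact div_pos_of_neg_of_neg (by linarith) h2

/-- Auxiliary step of the isogeny / two-torsion computation (F9–F10). [folklore] -/
theorem Ψ_lt_one {x : ℝ} (h3 : e₃ < x) (h2 : x < e₂) : Ψ x < 1 := by
  have hx2 : x < 2 := h2.trans e₂_lt_two
  have key := Ψ_sub_one hx2.ne
  have hq : (x - e₂) * (x - e₃) < 0 := mul_neg_of_neg_of_pos (by linarith) (by linarith)
  have : -((x - e₂) * (x - e₃)) / (4 * (x - 2)) < 0 :=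
    div_neg_of_pos_of_neg (by linarith) (by linarith)
  linarith

/-- Auxiliary step of the isogeny / two-torsion computation (F9–F10). [folklore] -/
theorem one_lt_Ψ {x : ℝ} (h2 : e₂ < x) (hx2 : x < 2) : 1 < Ψ x := by
  have key := Ψ_sub_one hx2.ne
  have hq : 0 < (x - e₂) * (x - e₃) := mul_pos (by linarith) (by linarith [e₃_lt_e₂])
  have : 0 < -((x - e₂) * (x - e₃)) / (4 * (x - 2)) :=
    div_pos_of_neg_of_neg (by linarith) (by linarith)
  linarith

/-- Auxiliary step of the isogeny / two-torsion computation (F9–F10). [folklore] -/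
theorem continuousOn_Ψ {S : Set ℝ} (hS : ∀ x ∈ S, x ≠ 2) : ContinuousOn Ψ S :=
  fun x hx => (hasDerivAt_Ψ (hS x hx)).continuousAt.continuousWithinAt

/-- injectivity of `Ψ` away from the involution `(x−2)(y−2) = 1`. [folklore] -/
theorem Ψ_injOn {S : Set ℝ} (hS : ∀ x ∈ S, x ≠ 2)
    (hprod : ∀ x ∈ S, ∀ y ∈ S, (x - 2) * (y - 2) ≠ 1) : InjOn Ψ S := by
  intro x hx y hy hxy
  have ha : x - 2 ≠ 0 := sub_ne_zero.mpr (hS x hx)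
  have hb : y - 2 ≠ 0 := sub_ne_zero.mpr (hS y hy)
  unfold Ψ at hxy
  have h1 : x + (x - 2)⁻¹ = y + (y - 2)⁻¹ := by linarith
  have ea : (x - 2) * (x - 2)⁻¹ = 1 := mul_inv_cancel₀ ha
  have eb : (y - 2) * (y - 2)⁻¹ = 1 := mul_inv_cancel₀ hb
  have h3 : (x + (x - 2)⁻¹) * ((x - 2) * (y - 2)) = (y + (y - 2)⁻¹) * ((x - 2) * (y - 2)) := by
    rw [h1]
  have h2 : (x - y) * ((x - 2) * (y - 2) - 1) = 0 := by
    linear_combination h3 - (y - 2) * ea + (x - 2) * eb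
  rcases mul_eq_zero.mp h2 with h | h
  · linarith
  · exact absurd (by linarith : (x - 2) * (y - 2) = 1) (hprod x hx y hy)

/-- Auxiliary step of the isogeny / two-torsion computation (F9–F10). [folklore] -/
theorem Ψ_injOn₁ : InjOn Ψ (Ioo e₂ 2) := by
  refine Ψ_injOn (fun x hx => hx.2.ne) (fun x hx y hy => ?_)
  have h1 : -1 < x - 2 := by linarith [hx.1, one_lt_e₂]
  have h2 : x - 2 < 0 := by linarith [hx.2]
  have h3 : -1 < y - 2 := by linarith [hy.1, one_lt_e₂]
  have h4 : y - 2 < 0 := by linarith [hy.2]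
  have : (x - 2) * (y - 2) < 1 := by nlinarith
  exact this.ne

/-- Auxiliary step of the isogeny / two-torsion computation (F9–F10). [folklore] -/
theorem Ψ_injOn₂ : InjOn Ψ (Ioo e₃ 1) := by
  refine Ψ_injOn (fun x hx => by linarith [hx.2]) (fun x hx y hy => ?_)
  have h2 : x - 2 < -1 := by linarith [hx.2]
  have h4 : y - 2 < -1 := by linarith [hy.2]
  have : 1 < (x - 2) * (y - 2) := by nlinarith
  exact this.ne'

/-- Auxiliary step of the isogeny / two-torsion computation (F9–F10). [folklore] -/
theorem Ψ_injOn₃ : InjOn Ψ (Ioo 1 e₂) := by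
  refine Ψ_injOn (fun x hx => by linarith [hx.2, e₂_lt_two]) (fun x hx y hy => ?_)
  have h1 : -1 < x - 2 := by linarith [hx.1]
  have h2 : x - 2 < 0 := by linarith [hx.2, e₂_lt_two]
  have h3 : -1 < y - 2 := by linarith [hy.1]
  have h4 : y - 2 < 0 := by linarith [hy.2, e₂_lt_two]
  have : (x - 2) * (y - 2) < 1 := by nlinarith
  exact this.ne

/-- Auxiliary step of the isogeny / two-torsion computation (F9–F10). [folklore] -/
theorem Ψ_image₁ : Ψ '' Ioo e₂ 2 = Ioi 1 := by
  apply Subset.antisymm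
  · rintro w ⟨x, hx, rfl⟩
    exact one_lt_Ψ hx.1 hx.2
  · intro w hw
    have hw : 1 < w := hw
    set b : ℝ := 2 - (4 * (w + 1))⁻¹ with hb
    have hw1 : 0 < 4 * (w + 1) := by linarith
    have hbinv : 0 < (4 * (w + 1))⁻¹ := inv_pos.mpr hw1
    have hbinv' : (4 * (w + 1))⁻¹ < 8⁻¹ := by
      apply inv_strictAnti₀ (by norm_num); linarith
    have hb2 : b < 2 := by rw [hb]; linarith
    have he₂b : e₂ < b := by
      rw [hb]; have := sqrt2_lt; unfold e₂; nlinarith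
    have hΨb : w < Ψ b := by
      have hb2' : b - 2 = -(4 * (w + 1))⁻¹ := by rw [hb]; ring
      unfold Ψ
      rw [hb2', inv_neg, inv_inv]
      rw [hb]
      nlinarith
    have hcont : ContinuousOn Ψ (Icc e₂ b) :=
      continuousOn_Ψ (fun x hx => by linarith [hx.2])
    have hivt := intermediate_value_Ioo he₂b.le hcont
    rw [Ψ_e₂] at hivt
    obtain ⟨x, hx, hxw⟩ := hivt ⟨hw, hΨb⟩
    exact ⟨x, ⟨hx.1, hx.2.trans hb2⟩, hxw⟩

/-- Auxiliary step of the isogeny / two-torsion computation (F9–F10). [folklore] -/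
theorem Ψ_image₂ : Ψ '' Ioo e₃ 1 = Ioo 0 1 := by
  apply Subset.antisymm
  · rintro w ⟨x, hx, rfl⟩
    exact ⟨Ψ_pos (by linarith [hx.2]) hx.2.ne, Ψ_lt_one hx.1 (hx.2.trans one_lt_e₂)⟩
  · have hcont : ContinuousOn Ψ (Icc e₃ 1) :=
      continuousOn_Ψ (fun x hx => by linarith [hx.2])
    have hivt := intermediate_value_Ioo' e₃_lt_one.le hcont
    rwa [Ψ_e₃, Ψ_one] at hivt

/-- Auxiliary step of the isogeny / two-torsion computation (F9–F10). [folklore] -/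
theorem Ψ_image₃ : Ψ '' Ioo 1 e₂ = Ioo 0 1 := by
  apply Subset.antisymm
  · rintro w ⟨x, hx, rfl⟩
    exact ⟨Ψ_pos (hx.2.trans e₂_lt_two) hx.1.ne', Ψ_lt_one (e₃_lt_one.trans hx.1) hx.2⟩
  · have hcont : ContinuousOn Ψ (Icc 1 e₂) :=
      continuousOn_Ψ (fun x hx => by linarith [hx.2, e₂_lt_two])
    have hivt := intermediate_value_Ioo one_lt_e₂.le hcont
    rwa [Ψ_e₂, Ψ_one] at hivt

/-! ### weights -/

/-- Auxiliary step of the isogeny / two-torsion computation (F9–F10). [folklore] -/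
theorem weight_helper {F P Q : ℝ} (hF : 0 < F) (hP : P ≠ 0) (hQ : Q = F * P ^ 2 / 4) :
    |P| * (Real.sqrt Q)⁻¹ = 2 * (Real.sqrt F)⁻¹ := by
  subst hQ
  rw [show F * P ^ 2 / 4 = F * (P / 2) ^ 2 by ring, Real.sqrt_mul hF.le, Real.sqrt_sq_eq_abs,
    abs_div, abs_two]
  have h1 : 0 < Real.sqrt F := Real.sqrt_pos.mpr hF
  have h2 : 0 < |P| := abs_pos.mpr hP
  field_simp

/-- Auxiliary step of the isogeny / two-torsion computation (F9–F10). [folklore] -/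
theorem Ψ'_ne {x : ℝ} (hx2 : x ≠ 2) (hx1 : x ≠ 1) (hx3 : x ≠ 3) : Ψ' x ≠ 0 := by
  have hx' : x - 2 ≠ 0 := sub_ne_zero.mpr hx2
  unfold Ψ'
  intro h
  have h1 : ((x - 2) ^ 2)⁻¹ = 1 := by linarith
  have h2 : (x - 2) ^ 2 = 1 := by
    have := congrArg (·⁻¹) h1
    simpa using this
  have h3 : (x - 1) * (x - 3) = 0 := by nlinarith
  rcases mul_eq_zero.mp h3 with h | h
  · exact hx1 (by linarith)
  · exact hx3 (by linarith)

/-- weight on the `f < 0` interval: `|Ψ'| g(Ψ) = 2/√(−f)`. [folklore] -/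
theorem weight_neg {x : ℝ} (h2 : e₂ < x) (hx2 : x < 2) :
    |Ψ' x| • gI (Ψ x) = 2 * (Real.sqrt (-fcm x))⁻¹ := by
  rw [smul_eq_mul]
  unfold gI
  refine weight_helper (by linarith [fcm_neg_of_mem h2 hx2])
    (Ψ'_ne hx2.ne (by linarith [one_lt_e₂]) (by linarith)) ?_
  rw [Ψ_key hx2.ne]

/-- weight on the bounded oval (off the fold `x = 1`): `|Ψ'| h(Ψ) = 2/√f`. [folklore] -/
theorem weight_pos {x : ℝ} (h3 : e₃ < x) (h2 : x < e₂) (hx1 : x ≠ 1) :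
    |Ψ' x| • hI (Ψ x) = 2 * (Real.sqrt (fcm x))⁻¹ := by
  rw [smul_eq_mul]
  unfold hI
  have hx2 : x < 2 := h2.trans e₂_lt_two
  refine weight_helper (fcm_pos_of_mem h3 h2) (Ψ'_ne hx2.ne hx1 (by linarith)) ?_
  have := Ψ_key hx2.ne
  linear_combination -this

/-! ### the three isogeny substitutions -/

/-- `K₀(44,−56) = Λ/4`. [folklore] -/
theorem integral_K_cm : ∫ x in Ioo e₂ 2, (Real.sqrt (-fcm x))⁻¹ = lemHalf / 2 := by
  have key := integral_image_eq_integral_abs_deriv_smul (s := Ioo e₂ 2) (f := Ψ) (f' := Ψ')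
    measurableSet_Ioo (fun x hx => (hasDerivAt_Ψ hx.2.ne).hasDerivWithinAt) Ψ_injOn₁ gI
  rw [Ψ_image₁, integral_gI_Ioi, setIntegral_congr_fun measurableSet_Ioo
    (fun x hx => weight_neg hx.1 hx.2), integral_const_mul] at key
  linarith

/-- Auxiliary step of the isogeny / two-torsion computation (F9–F10). [folklore] -/
theorem integral_J_half {S : Set ℝ} (hS : MeasurableSet S) (himg : Ψ '' S = Ioo 0 1)
    (hinj : InjOn Ψ S) (hS2 : ∀ x ∈ S, e₃ < x ∧ x < e₂ ∧ x ≠ 1) :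
    ∫ x in S, (Real.sqrt (fcm x))⁻¹ = lemHalf / 2 ∧
      IntegrableOn (fun x => (Real.sqrt (fcm x))⁻¹) S := by
  have hder : ∀ x ∈ S, HasDerivWithinAt Ψ (Ψ' x) S x := fun x hx =>
    (hasDerivAt_Ψ ((hS2 x hx).2.1.trans e₂_lt_two).ne).hasDerivWithinAt
  have hw : EqOn (fun x => |Ψ' x| • hI (Ψ x)) (fun x => 2 * (Real.sqrt (fcm x))⁻¹) S :=
    fun x hx => weight_pos (hS2 x hx).1 (hS2 x hx).2.1 (hS2 x hx).2.2
  have key := integral_image_eq_integral_abs_deriv_smul hS hder hinj hI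
  rw [himg, integral_hI_Ioo, setIntegral_congr_fun hS hw, integral_const_mul] at key
  have hint := (integrableOn_image_iff_integrableOn_abs_deriv_smul hS hder hinj hI)
  rw [himg] at hint
  have hint2 := (hint.mp integrableOn_hI_Ioo).congr_fun hw hS
  have hint3 : IntegrableOn (fun x => 1 / 2 * (2 * (Real.sqrt (fcm x))⁻¹)) S :=
    hint2.const_mul (1 / 2 : ℝ)
  refine ⟨by linarith, ?_⟩
  refine hint3.congr_fun (fun x _ => ?_) hS
  ring

/-- `J₀(44,−56) = Λ/2`. [folklore] -/
theorem integral_J_cm : ∫ x in Ioo e₃ e₂, (Real.sqrt (fcm x))⁻¹ = lemHalf := by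
  obtain ⟨hI₂, hi₂⟩ := integral_J_half measurableSet_Ioo Ψ_image₂ Ψ_injOn₂
    (fun x hx => ⟨hx.1, hx.2.trans one_lt_e₂, hx.2.ne⟩)
  obtain ⟨hI₃, hi₃⟩ := integral_J_half measurableSet_Ioo Ψ_image₃ Ψ_injOn₃
    (fun x hx => ⟨e₃_lt_one.trans hx.1, hx.2, hx.1.ne'⟩)
  have hsplit : Ioo e₃ e₂ \ {1} = Ioo e₃ 1 ∪ Ioo 1 e₂ := by
    ext x
    simp only [mem_sdiff, mem_Ioo, mem_singleton_iff, mem_union]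
    constructor
    · rintro ⟨⟨h1, h2⟩, h3⟩
      rcases lt_or_gt_of_ne h3 with h | h
      · exact Or.inl ⟨h1, h⟩
      · exact Or.inr ⟨h, h2⟩
    · rintro (⟨h1, h2⟩ | ⟨h1, h2⟩)
      · exact ⟨⟨h1, h2.trans one_lt_e₂⟩, h2.ne⟩
      · exact ⟨⟨e₃_lt_one.trans h1, h2⟩, h1.ne'⟩
  have hae : (Ioo e₃ e₂ \ {1} : Set ℝ) =ᵐ[volume] Ioo e₃ e₂ :=
    sdiff_null_ae_eq_self (by simp)
  rw [← setIntegral_congr_set hae, hsplit,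
    setIntegral_union (Set.disjoint_left.mpr fun x hx hx' => lt_irrefl x (hx.2.trans hx'.1))
      measurableSet_Ioo hi₂ hi₃, hI₂, hI₃]
  ring

/-- **The integer period relation at `j = 66³`: `J₀ = 2K₀`.** [folklore] -/
theorem J_eq_two_K_cm :
    ∫ x in Ioo e₃ e₂, (Real.sqrt (fcm x))⁻¹ = 2 * ∫ x in Ioo e₂ 2, (Real.sqrt (-fcm x))⁻¹ := by
  rw [integral_J_cm, integral_K_cm]; ring

end Summit.KontsevichZagierPeriods.RealEllipticSectorKernel.CM66

end
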